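import Mathlib
import Summits.Ventures.PercRepro2.Defs
import Summits.Ventures.PercRepro2.Graph
import Summits.Ventures.PercRepro2.HullDefs
import Summits.Ventures.PercRepro2.LocRows
import Summits.Ventures.PercRepro2.SwRow
import Summits.Ventures.PercRepro2.SwGlue2
import Summits.Ventures.PercRepro2.SwAllRow

/-!
# Row 2′SW-ALL across the cut `{l, h}` (blind cell PercRepro2, night-4 g5, 2026-08-24;
proofs/NIGHT4-BRIDGE.md §1, §3)

The bridge lemma `Glue2.sw_glue2` for the rigid row `LocRows.SwAll`: the permutation
`(Φ₁, colour swap of the second side)` flips every red edge inside the red cluster of `h` — on the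
first side by the rigid property of `Φ₁` (the red cluster of `h` meets the first side exactly in its
first-side cluster), on the second side because the whole side is swapped.
-/

namespace Summit.Ventures.PercRepro2

namespace Glue2

open Hull LocRows

open scoped Classical

variable {V : Type*} {E₁ E₂ : Type*}
variable {ends₁ : E₁ → Sym2 V} {ends₂ : E₂ → Sym2 V} {l h : V} {V₁ V₂ : Set V}

/-- An edge of the first side inside a set `S` lies inside `S ∩ V₁`. -/
lemma mem_within_inl (hg : IsGluing2 ends₁ ends₂ l h V₁ V₂) {S : Set V} {e : E₁}
    (he : Sum.inl e ∈ within (glue2 ends₁ ends₂) S) : e ∈ within ends₁ (S ∩ V₁) := by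
  obtain ⟨x, hx, y, hy, hends⟩ := he
  refine ⟨x, ⟨hx, hg.mem₁ e x ?_⟩, y, ⟨hy, hg.mem₁ e y ?_⟩, hends⟩
  · rw [show ends₁ e = s(x, y) from hends]; exact Sym2.mem_mk_left x y
  · rw [show ends₁ e = s(x, y) from hends]; exact Sym2.mem_mk_right x y

/-- On `Q`, the red cluster of `h` meets the first side exactly in its first-side cluster. -/
lemma cluster_h_inter_eq (hg : IsGluing2 ends₁ ends₂ l h V₁ V₂) {ζ : Config (E₁ ⊕ E₂)}
    (hζ : h ∉ cluster (glue2 ends₁ ends₂) ζ l) :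
    cluster (glue2 ends₁ ends₂) ζ h ∩ V₁ = cluster ends₁ (ζ ∘ Sum.inl) h := by
  rw [cluster_h_of_not_mem hg hζ]
  ext x
  simp only [Set.mem_inter_iff, Set.mem_union]
  constructor
  · rintro ⟨hx | hx, hxV₁⟩
    · exact hx
    · have hxV₂ : x ∈ V₂ := cluster₂_subset hg hg.h_mem₂ hx
      rcases hg.inter x hxV₁ hxV₂ with hxl | hxh
      · exfalso
        apply hζ
        rw [hxl] at hx
        exact conn_glue2_of_conn₂ (mem_cluster_comm'.1 hx)
      · rw [hxh]; exact mem_cluster_self _ _ _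
  · intro hx
    exact ⟨Or.inl hx, cluster₁_subset hg hg.h_mem₁ hx⟩

variable [Fintype E₁] [DecidableEq E₁] [Fintype E₂] [DecidableEq E₂]

/-- **The bridge lemma for 2′SW-ALL**: the rigid row on the first side gives the rigid row on the
glued graph, for `o` on the first side. -/
theorem swAll_glue2 (hg : IsGluing2 ends₁ ends₂ l h V₁ V₂) {o : V} (ho : o ∈ V₁) (hol : o ≠ l)
    (hoh : o ≠ h) (hs : SwAll ends₁ l h o) : SwAll (glue2 ends₁ ends₂) l h o := by
  obtain ⟨f, hf, hmem⟩ := hs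
  refine ⟨fun x => pair2 (f ⟨x.1 ∘ Sum.inl, ((mem_tgtU_glue2_iff hg ho hol hoh).1 x.2).1⟩)
    (blue (x.1 ∘ Sum.inr)), ?_, ?_⟩
  · intro x y hxy
    have h₁ : f ⟨x.1 ∘ Sum.inl, ((mem_tgtU_glue2_iff hg ho hol hoh).1 x.2).1⟩ =
        f ⟨y.1 ∘ Sum.inl, ((mem_tgtU_glue2_iff hg ho hol hoh).1 y.2).1⟩ := by
      have := congrArg (fun ζ => ζ ∘ Sum.inl) hxy
      simpa [pair2_inl] using this
    have h₂ : blue (x.1 ∘ Sum.inr) = blue (y.1 ∘ Sum.inr) := by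
      have := congrArg (fun ζ => ζ ∘ Sum.inr) hxy
      simpa [pair2_inr] using this
    have e₁ : x.1 ∘ Sum.inl = y.1 ∘ Sum.inl := congrArg Subtype.val (hf h₁)
    have e₂ : x.1 ∘ Sum.inr = y.1 ∘ Sum.inr := by
      have := congrArg blue h₂
      simpa [blue_blue] using this
    apply Subtype.ext
    rw [← pair2_sides x.1, ← pair2_sides y.1, e₁, e₂]
  · intro x
    obtain ⟨hx₁, hx₂⟩ := (mem_tgtU_glue2_iff hg ho hol hoh).1 x.2
    obtain ⟨hft, hflip⟩ := hmem ⟨x.1 ∘ Sum.inl, hx₁⟩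
    have himg : pair2 (f ⟨x.1 ∘ Sum.inl, hx₁⟩) (blue (x.1 ∘ Sum.inr)) ∈
        tgtU (glue2 ends₁ ends₂) l h {S : Set V | o ∈ S} := by
      rw [mem_tgtU_glue2_iff hg ho hol hoh, pair2_inl, pair2_inr]
      exact ⟨hft, noMono_blue hx₂⟩
    refine ⟨himg, ?_⟩
    intro e he hred
    rcases e with e | e
    · -- an edge of the first side inside the red cluster of `h`: the rigid property of `Φ₁`
      have he' : e ∈ within ends₁ (cluster ends₁ (x.1 ∘ Sum.inl) h) := by
        rw [← cluster_h_inter_eq hg (not_mem_of_mem_tgtU x.2).1]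
        exact mem_within_inl hg he
      exact hflip e he' hred
    · -- an edge of the second side: swapped
      show blue (x.1 ∘ Sum.inr) e = false
      rw [blue_apply]
      have : (x.1 ∘ Sum.inr) e = true := hred
      rw [this]; rfl

end Glue2

end Summit.Ventures.PercRepro2
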